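import Mathlib.FieldTheory.IsAlgClosed.Basic
import Literature.NumberTheory.EllipticCurves.GaloisAction
import HarnessLib

/-!
# Divisibility of the geometric points: `[n] : E(K̄) → E(K̄)` is surjective

Trunk T-ELLARITH; serves the named fact `WeierstrassCurve.exists_kummerMap` of
`Literature.NumberTheory.EllipticCurves.Selmer` (Silverman, *AEC*, VIII.§2 and X.4.2(a)), whose
proof (file `SelmerProofs`) starts, as Silverman's does (VIII.§2, first display), from the short
exact sequence of `G_{K̄/K}`-modules
`0 → E[m] → E(K̄) →[m] E(K̄) → 0`,
i.e. from the **surjectivity of multiplication by `m ≠ 0` on `E(K̄)`**. Silverman obtains it from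
Prop. III.4.2(a) (`[m]` is a nonconstant isogeny) and Thm. II.2.3 (a nonconstant morphism of
curves is surjective), neither of which is available in Mathlib. This file

* records that statement as the named fact `WeierstrassCurve.zsmul_geomPoints_surjective`
  (for an elliptic curve `W/F` and `n ≠ 0`, `Q ↦ n • Q` is onto on `geomPoints W = E(F̄)`); it is
  *proved* from Silverman's Exercise 3.7(d),(f) (division polynomials) in the companion file
  `DivisionPolynomialMultiples` (`zsmul_geomPoints_surjective_of_divisionPolynomial`);
* vendors Prop. III.2.5 (the group `E_ns(K̄)` of nonsingular points of a *singular* Weierstrass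
  cubic is `K̄ˣ` for a node, `K̄⁺` for a cusp) as the named facts
  `WeierstrassCurve.nonempty_geomPoints_addEquiv_units_of_node`,
  `WeierstrassCurve.nonempty_geomPoints_addEquiv_of_cusp`, and **proves** from them that
  `Q ↦ n • Q` is onto on `geomPoints W` for a singular `W` over a field of characteristic `0`
  (`zsmul_geomPoints_surjective_of_singular`), and finally for *every* Weierstrass curve over a
  field of characteristic `0` (`zsmul_geomPoints_surjective_of_facts`). (Mathlib's — and hence
  this project's — `W.toAffine.Point` is Silverman's `E_ns ∪ {O}` when `W` is singular, and
  `exists_kummerMap` is stated without an `IsElliptic` hypothesis, whence the singular case.)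

## References

* [SilvermanAEC2009] J. H. Silverman, *The Arithmetic of Elliptic Curves*, 2nd ed., GTM 106,
  Springer 2009, doi:10.1007/978-0-387-09494-6: Thm. II.2.3; Prop. III.1.4(a); Prop. III.2.5
  (book p. 56) and Exercise 3.5; Prop. III.4.2(a); §VIII.2 (first display, the sequence
  `0 → E[m] → E(K̄) → E(K̄) → 0`).

## Design

* Deliberate dot-notation extensions in `namespace WeierstrassCurve`, under `open scoped Classical`
  (the convention of `GaloisAction`, so that `n • Q` refers to `geomPoints.instAddCommGroup`).
* Prop. III.2.5 is vendored in the weakened, coordinate-free form "a group isomorphism exists"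
  (`Nonempty (_ ≃+ _)`), which is all that divisibility needs; the node/cusp dichotomy is phrased
  by `c₄ ≠ 0` / `c₄ = 0` exactly as in III.1.4(a) and III.2.5 (valid in every characteristic:
  after moving the singular point to the origin, `c₄ = (a₁² + 4a₂)²` is the squared discriminant
  of the tangent cone, proof of III.1.4(a)).
-/

noncomputable section

universe u

namespace WeierstrassCurve

open scoped Classical

variable {F : Type u} [Field F] (W : WeierstrassCurve F)

/-- **Named fact (Silverman, AEC, §VIII.2 with Prop. III.4.2(a) and Thm. II.2.3):
multiplication by `m ≠ 0` is surjective on `E(K̄)`.** For an elliptic curve `E/K` and an integer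
`m ≠ 0`, the multiplication-by-`m` map `[m] : E → E` is a nonconstant isogeny (III.4.2(a)), hence
surjective on `K̄`-points (II.2.3: a morphism of curves is either constant or surjective), so that
`0 → E[m] → E(K̄) →[m] E(K̄) → 0` is a short exact sequence of `G_{K̄/K}`-modules (§VIII.2, first
display; there `m ≥ 2` and `K` is a number field, but the argument is the cited one for any field
and any `m ≠ 0`). In Lean: `Q ↦ n • Q` is onto on `geomPoints W = E(F̄)`. Proved from the
division-polynomial facts (Exercise 3.7(d),(f)) in file `DivisionPolynomialMultiples`
(`zsmul_geomPoints_surjective_of_divisionPolynomial`).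
[cite: SilvermanAEC2009, §VIII.2 (sequence 0 → E[m] → E(K̄) → E(K̄) → 0), Prop. III.4.2(a), Thm. II.2.3] -/
def zsmul_geomPoints_surjective : Prop :=
  ∀ [W.IsElliptic] {n : ℤ}, n ≠ 0 → Function.Surjective fun Q : geomPoints W => n • Q

/-! ## Singular Weierstrass cubics: Prop. III.2.5 and divisibility of `E_ns(F̄)` -/

/-- **Silverman, AEC, Prop. III.2.5(a)** (the nodal case). Let `E` be a curve given by a
Weierstrass equation with `Δ = 0`, so `E` has a singular point `S`; the composition law makes
`E_ns` (the nonsingular points over `K̄`, together with `O`) into an abelian group. Suppose that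
`E` has a node, i.e. `c₄ ≠ 0` (III.1.4(a)), and let `y = α₁x + β₁`, `y = α₂x + β₂` be the distinct
tangent lines at `S`. Then `E_ns → K̄ˣ`, `(x, y) ↦ (y - α₁x - β₁)/(y - α₂x - β₂)` is an isomorphism
of abelian groups. Vendored in the weakened coordinate-free form: `E_ns(F̄) = geomPoints W`
(Mathlib's points are the nonsingular ones) is isomorphic to `F̄ˣ` as a group.
[cite: SilvermanAEC2009, Prop. III.2.5(a)] -/
def nonempty_geomPoints_addEquiv_units_of_node : Prop :=
  W.Δ = 0 → W.c₄ ≠ 0 → Nonempty (geomPoints W ≃+ Additive (AlgebraicClosure F)ˣ)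

/-- **Silverman, AEC, Prop. III.2.5(b)** (the cuspidal case). Let `E` be a curve given by a
Weierstrass equation with `Δ = 0` and suppose that `E` has a cusp, i.e. `c₄ = 0` (III.1.4(a)); let
`y = αx + β` be the tangent line at the singular point `S`. Then
`E_ns → K̄⁺`, `(x, y) ↦ (x - x(S))/(y - αx - β)` is an isomorphism of abelian groups. Vendored in
the weakened coordinate-free form: `geomPoints W ≃+ F̄⁺` exists.
[cite: SilvermanAEC2009, Prop. III.2.5(b)] -/
def nonempty_geomPoints_addEquiv_of_cusp : Prop :=
  W.Δ = 0 → W.c₄ = 0 → Nonempty (geomPoints W ≃+ AlgebraicClosure F)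

/-- Transport of divisibility along a group isomorphism. [folklore] -/
theorem zsmul_surjective_of_addEquiv {A B : Type*} [AddCommGroup A] [AddCommGroup B]
    (e : A ≃+ B) {n : ℤ} (h : Function.Surjective fun b : B => n • b) :
    Function.Surjective fun a : A => n • a := by
  intro a
  obtain ⟨b, hb⟩ := h (e a)
  have hb' : n • b = e a := hb
  refine ⟨e.symm b, ?_⟩
  change n • e.symm b = a
  rw [← map_zsmul e.symm n b, hb', e.symm_apply_apply]

/-- In an algebraically closed field every unit is an `n`-th power for `n ≠ 0`
(`Additive Kˣ` is a divisible group). [folklore] -/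
theorem zsmul_additive_units_surjective (L : Type*) [Field L] [IsAlgClosed L] {n : ℤ}
    (hn : n ≠ 0) : Function.Surjective fun u : Additive Lˣ => n • u := by
  intro u
  obtain ⟨z, hz⟩ := IsAlgClosed.exists_pow_nat_eq ((Additive.toMul u : Lˣ) : L)
    (Int.natAbs_pos.mpr hn)
  have hz0 : z ≠ 0 := by
    rintro rfl
    rw [zero_pow (Int.natAbs_ne_zero.mpr hn)] at hz
    exact (Additive.toMul u).ne_zero hz.symm
  have hv : (Units.mk0 z hz0) ^ n.natAbs = Additive.toMul u := Units.ext (by simpa using hz)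
  rcases Int.natAbs_eq n with h | h
  · refine ⟨Additive.ofMul (Units.mk0 z hz0), ?_⟩
    change Additive.ofMul ((Units.mk0 z hz0) ^ n) = u
    rw [h, zpow_natCast, hv, ofMul_toMul]
  · refine ⟨Additive.ofMul (Units.mk0 z hz0)⁻¹, ?_⟩
    change Additive.ofMul ((Units.mk0 z hz0)⁻¹ ^ n) = u
    rw [h, inv_zpow', neg_neg, zpow_natCast, hv, ofMul_toMul]

/-- In characteristic `0` the additive group of a field is divisible. [folklore] -/
theorem zsmul_field_surjective (L : Type*) [Field L] [CharZero L] {n : ℤ} (hn : n ≠ 0) :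
    Function.Surjective fun z : L => n • z := by
  intro w
  refine ⟨w / n, ?_⟩
  have hn' : (n : L) ≠ 0 := Int.cast_ne_zero.mpr hn
  change n • (w / n) = w
  rw [zsmul_eq_mul, mul_div_cancel₀ w hn']

/-- **Divisibility of `E_ns(F̄)` for a singular Weierstrass cubic in characteristic `0`**, from
Prop. III.2.5: `E_ns(F̄)` is `F̄ˣ` (node) or `F̄⁺` (cusp), and both are `n`-divisible for `n ≠ 0`
(`F̄` algebraically closed of characteristic `0`). Silverman, *AEC*, Prop. III.2.5 and
Exercise 3.5. [folklore] -/
theorem zsmul_geomPoints_surjective_of_singular [CharZero F]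
    (ha : W.nonempty_geomPoints_addEquiv_units_of_node) (hb : W.nonempty_geomPoints_addEquiv_of_cusp)
    (hΔ : W.Δ = 0) {n : ℤ} (hn : n ≠ 0) :
    Function.Surjective fun Q : geomPoints W => n • Q := by
  by_cases hc : W.c₄ = 0
  · obtain ⟨e⟩ := hb hΔ hc
    exact zsmul_surjective_of_addEquiv e (zsmul_field_surjective (AlgebraicClosure F) hn)
  · obtain ⟨e⟩ := ha hΔ hc
    exact zsmul_surjective_of_addEquiv e (zsmul_additive_units_surjective (AlgebraicClosure F) hn)

/-- **`[n] : E(F̄) → E(F̄)` is onto for every Weierstrass curve over a field of characteristic `0`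
and every `n ≠ 0`**, granted the named facts: `zsmul_geomPoints_surjective` (elliptic case;
Silverman VIII.§2 / III.4.2(a) / II.2.3) and Prop. III.2.5 (singular case).
Silverman, *AEC*, §VIII.2, Prop. III.2.5. [folklore] -/
theorem zsmul_geomPoints_surjective_of_facts [CharZero F] (h : W.zsmul_geomPoints_surjective)
    (ha : W.nonempty_geomPoints_addEquiv_units_of_node) (hb : W.nonempty_geomPoints_addEquiv_of_cusp)
    {n : ℤ} (hn : n ≠ 0) : Function.Surjective fun Q : geomPoints W => n • Q := by
  by_cases hΔ : W.Δ = 0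
  · exact W.zsmul_geomPoints_surjective_of_singular ha hb hΔ hn
  · haveI : W.IsElliptic := ⟨isUnit_iff_ne_zero.mpr hΔ⟩
    exact h hn

end WeierstrassCurve
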